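import Summits.CriticalPhenomena.PercolationContinuityZ3.Theorems.PercNearOneGluingNoHeavyRsw3VolumeFatClusters
import Summits.CriticalPhenomena.PercolationContinuityZ3.Theorems.PercAnnulusCrossingIICPlanarKesten
import HarnessLib

/-!
# RSW3 lane (P2, gen 19): THE VOLUME–RADIUS HYPERSCALING RELATION `dρ = δ + 1` UNDER (A2)□, IN RATIO FORM, and the two-sided
# `χ_n ≍ n^d π_n²` — `P_{p_c}(|C(0)| ≥ λ|Λ(n)|π(n)) ≍ π(n)` and `E|C(0) ∩ Λ(n)| ≍ |Λ(n)|π(n)²` at `p_c(ℤ^d)`; `ℤ²` unconditional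

builds on p205010 (kernel theorem, internal audit signed; external expert review pending) — NOT used in this file.

Cell `prim-rsw3`, prover seat `prim-rsw3-p2` (gen 19), memo `run/shared/lean/prim/rsw3/P2-RSWLITE.md` §26.
Support file (`--supports stmt-CriticalPhenomena-4575`); no definitions, no named facts, no sorries.

At `p_c(ℤ^d)`, `d ≥ 2`, under Basu–Sapozhnikov's set-to-set quasi-multiplicativity (A2)□ at one aspect
(`SetToSetQuasiMultAspectAt d p_c s L ϰ`, `2 ≤ s ≤ L`, `ϰ > 0` — the single open input of the LANE-4 IIC construction; OPEN on `ℤ³`):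
* `exists_sq_oneArmProb_ratio_…` / `exists_oneArmProb_ratio_…` — the ratio inequalities (R1) `π(j)²(j/16n)^{d−1} ≤ Aπ(n)²` and
  (R2) `π(j) ≤ Bπ(n)` (`n ≤ 8j`) from one-arm quasi-multiplicativity (lead/p1, from (A2)□) and the square-root / linear annulus windows;
* **`exists_sum_tau_le_…` / `exists_sum_tau_two_sided_…`: `c(2n+1)^dπ(n)² ≤ Σ_{z∈Λ(n)} τ_{p_c}(0,z) ≤ C(2n+1)^dπ(n)²`** — the
  expected cluster size in a box is volume × (one-arm)², TWO-SIDED (lower half gen 18; the lead's V165 has it from blocking);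
  Kesten's `2 − η = d − 2/ρ` in summed form;
* **`exists_le_real_volume_ge_…`: `∃ λ, c > 0, ∀ n ≥ 1, c·π(n) ≤ P( λ(2n+1)^dπ(n) ≤ #{z ∈ Λ(n) : 0 ↔ z} ∧ 0 ↔ ∂ⁱⁿΛ(⌊n/2⌋) )`** —
  FAT CLUSTERS AT THE IIC SCALE; conditional form `exists_le_real_volume_ge_cond_…`: given the arm to `∂ⁱⁿΛ(⌊n/2⌋)` the cluster has
  volume `≥ λ|Λ(n)|π(n)` with probability `≥ c`;
* `exists_mul_sq_oneArmProb_le_real_openConnIn_…`, **`exists_le_real_localVolume_ge_…`** — the same with the LOCAL count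
  `#{z ∈ Λ(n) : 0 ↔ z in Λ(4n)}` (an event determined inside `Λ(4n)`, for independence across boxes);
* **`exists_real_volume_ge_le_…`: `P( λ(2n+1)^dπ(n) ≤ #{z ∈ Λ(R) : 0 ↔ z} ) ≤ C(λ)·π(n)` for every `R`**;
* **`exists_real_volume_ge_two_sided_…`: `c π(n) ≤ P(|C(0) ∩ Λ(R)| ≥ λ|Λ(n)|π(n)) ≤ C π(n)` for all `1 ≤ n ≤ R`** — the
  Borgs–Chayes–Kesten–Spencer volume–radius hyperscaling relation `dρ = δ + 1` in finite-size ratio form (if `π(n) ≈ n^{−1/ρ}` and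
  `P(|C| ≥ s) ≈ s^{−1/δ}`, then `δ = dρ − 1`), from the single LANE-4 input, in every dimension, no exponent assumed
  (BCKS derive it from RSW-type box-crossing postulates and the existence of `ρ`; the inequality `η₁(δ+1) ≤ d` is their unconditional
  half);
* `exists_sum_tau_two_sided_Z2`, `exists_real_volume_ge_two_sided_Z2` — the PLANAR instances at `p_c(ℤ²) = 1/2`, UNCONDITIONAL
  (p1's planar (A2)□ from RSW; Kesten 1986/1987: `91/5 = 2·(48/5) − 1`).

References: C. Borgs, J. Chayes, H. Kesten, J. Spencer, *Uniform boundedness of critical crossing probabilities implies hyperscaling*,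
Random Structures Algorithms 15 (1999) 368–413 (hyperscaling relations `dρ = δ + 1`, `2 − η = d(δ−1)/(δ+1)` under box-crossing
postulates) [BorgsChayesKestenSpencer1999]; H. Kesten, PTRF 73 (1986), Thm. (8) (volume of the planar IIC) [Kesten1986]; H. Kesten,
Comm. Math. Phys. 109 (1987) (scaling relations) [Kesten1987]; D. Basu, A. Sapozhnikov, ECP 22 (2017), §1 (A2) [BasuSapozhnikov2017ECP];
R. Lyons, Y. Peres, *Probability on Trees and Networks* (2016), §5.5 (Paley–Zygmund) [LyonsPeres2016]; G. Grimmett, *Percolation*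
(1999), §2.2 (disjoint-support independence) [GrimmettPercolation1999]. [folklore]
-/

noncomputable section

namespace Summit.CriticalPhenomena.PercolationContinuityZ3.Theorems

namespace Rsw3

open MeasureTheory Literature.Probability.LatticeModels Literature.Probability.Percolation
open SurfaceTension Crossing SimpleGraph

variable {d : ℕ}

/-! ## At `p_c(ℤ^d)` under (A2)□ — the ratio inequalities (R1), (R2) -/

/-- **(R1) at `p_c(ℤ^d)` from (A2)□** (`d ≥ 2`, `2 ≤ s ≤ L`, `ϰ > 0`): `∃ A > 0, π(j)²·(j/(16n))^{d−1} ≤ A·π(n)²` for `1 ≤ j ≤ n` —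
one-arm quasi-multiplicativity `c π(j) u(j,n) ≤ π(n)` (lead gen 3 / p1, from (A2)□) squared, with the SQUARE-ROOT annulus window
`u(j,n)² ≥ (2d)⁻¹ (j/(16n))^{d−1}` of gen 2. [cite: BasuSapozhnikov2017ECP, §1 assumption (A2)] [cite: Kesten1982, Cor. 5.1] -/
theorem exists_sq_oneArmProb_ratio_of_setToSetQuasiMultAspectAt (hd : 2 ≤ d) {s L : ℕ} (hs : 2 ≤ s) (hsL : s ≤ L) {ϰ : ℝ}
    (hϰ : 0 < ϰ) (h : SetToSetQuasiMultAspectAt d (criticalProbI d) s L ϰ) :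
    ∃ A : ℝ, 0 < A ∧ ∀ j n : ℕ, 1 ≤ j → j ≤ n →
      oneArmProb d (criticalProbI d) j ^ 2 * ((j : ℝ) / (16 * n)) ^ (d - 1) ≤ A * oneArmProb d (criticalProbI d) n ^ 2 := by
  obtain ⟨c, hc, hQM⟩ := oneArmQuasiMultAt_of_setToSetQuasiMultAspectAt hd hs hsL hϰ h
  have hd0 : (0 : ℝ) < d := by exact_mod_cast (by omega : 0 < d)
  refine ⟨2 * d / c ^ 2, by positivity, fun j n hj hjn => ?_⟩
  set μ := bondPercolation (zdGraph d) (criticalProbI d) with hμ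
  have hqm := hQM j n hj hjn
  have hwin := le_sq_real_boxCrossing_criticalProbI hd hj hjn
  have hπj : 0 ≤ oneArmProb d (criticalProbI d) j := measureReal_nonneg
  have hu : 0 ≤ μ.real (boxCrossing d j n) := measureReal_nonneg
  -- square the quasi-multiplicativity inequality
  have hsq : (c * (oneArmProb d (criticalProbI d) j * μ.real (boxCrossing d j n))) ^ 2 ≤ oneArmProb d (criticalProbI d) n ^ 2 :=
    pow_le_pow_left₀ (mul_nonneg hc.le (mul_nonneg hπj hu)) hqm 2
  have h1 : c ^ 2 * (oneArmProb d (criticalProbI d) j ^ 2 * ((2 * (d : ℝ))⁻¹ * ((j : ℝ) / (16 * n)) ^ (d - 1))) ≤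
      oneArmProb d (criticalProbI d) n ^ 2 :=
    calc c ^ 2 * (oneArmProb d (criticalProbI d) j ^ 2 * ((2 * (d : ℝ))⁻¹ * ((j : ℝ) / (16 * n)) ^ (d - 1)))
        ≤ c ^ 2 * (oneArmProb d (criticalProbI d) j ^ 2 * μ.real (boxCrossing d j n) ^ 2) :=
          mul_le_mul_of_nonneg_left (mul_le_mul_of_nonneg_left hwin (sq_nonneg _)) (sq_nonneg c)
      _ = (c * (oneArmProb d (criticalProbI d) j * μ.real (boxCrossing d j n))) ^ 2 := by ring
      _ ≤ oneArmProb d (criticalProbI d) n ^ 2 := hsq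
  have h2 : oneArmProb d (criticalProbI d) j ^ 2 * ((j : ℝ) / (16 * n)) ^ (d - 1) =
      2 * d / c ^ 2 * (c ^ 2 * (oneArmProb d (criticalProbI d) j ^ 2 * ((2 * (d : ℝ))⁻¹ * ((j : ℝ) / (16 * n)) ^ (d - 1)))) := by
    field_simp
  rw [h2]
  exact mul_le_mul_of_nonneg_left h1 (by positivity)

/-- **(R2) at `p_c(ℤ^d)` from (A2)□** (`d ≥ 2`, `2 ≤ s ≤ L`, `ϰ > 0`): `∃ B > 0, π(j) ≤ B·π(n)` for `1 ≤ j ≤ n ≤ 8j` — one-arm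
quasi-multiplicativity and the annulus window `u(j,n) ≥ (2d)⁻¹(j/(4n))^{d−1} ≥ (2d)⁻¹ 32^{1−d}` at aspect `≤ 8`.
[cite: BasuSapozhnikov2017ECP, §1 assumption (A2)] [cite: Kesten1982, Cor. 5.1] -/
theorem exists_oneArmProb_ratio_of_setToSetQuasiMultAspectAt (hd : 2 ≤ d) {s L : ℕ} (hs : 2 ≤ s) (hsL : s ≤ L) {ϰ : ℝ}
    (hϰ : 0 < ϰ) (h : SetToSetQuasiMultAspectAt d (criticalProbI d) s L ϰ) :
    ∃ B : ℝ, 0 < B ∧ ∀ j n : ℕ, 1 ≤ j → j ≤ n → n ≤ 8 * j →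
      oneArmProb d (criticalProbI d) j ≤ B * oneArmProb d (criticalProbI d) n := by
  obtain ⟨c, hc, hQM⟩ := oneArmQuasiMultAt_of_setToSetQuasiMultAspectAt hd hs hsL hϰ h
  have hd0 : (0 : ℝ) < d := by exact_mod_cast (by omega : 0 < d)
  set w : ℝ := (2 * (d : ℝ))⁻¹ * ((32 : ℝ) ^ (d - 1))⁻¹ with hw
  have hwpos : 0 < w := by positivity
  refine ⟨(c * w)⁻¹, by positivity, fun j n hj hjn hn8 => ?_⟩
  set μ := bondPercolation (zdGraph d) (criticalProbI d) with hμ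
  have hqm := hQM j n hj hjn
  have hwin := le_real_boxCrossing_criticalProbI_of_le hd hj hjn
  have hj0 : (0 : ℝ) < j := by exact_mod_cast hj
  have hn0 : (0 : ℝ) < n := by exact_mod_cast (lt_of_lt_of_le hj hjn)
  have hπj : 0 ≤ oneArmProb d (criticalProbI d) j := measureReal_nonneg
  -- the window at aspect `≤ 8`
  have hw' : w ≤ μ.real (boxCrossing d j n) := by
    refine le_trans ?_ hwin
    rw [hw]
    refine mul_le_mul_of_nonneg_left ?_ (by positivity)
    rw [← inv_pow, ← one_div]
    refine pow_le_pow_left₀ (by positivity) ?_ _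
    rw [div_le_div_iff₀ (by norm_num) (by positivity)]
    have : (n : ℝ) ≤ 8 * j := by exact_mod_cast hn8
    linarith
  have h1 : c * w * oneArmProb d (criticalProbI d) j ≤ oneArmProb d (criticalProbI d) n :=
    calc c * w * oneArmProb d (criticalProbI d) j = c * (oneArmProb d (criticalProbI d) j * w) := by ring
      _ ≤ c * (oneArmProb d (criticalProbI d) j * μ.real (boxCrossing d j n)) :=
          mul_le_mul_of_nonneg_left (mul_le_mul_of_nonneg_left hw' hπj) hc.le
      _ ≤ oneArmProb d (criticalProbI d) n := hqm
  rw [inv_mul_eq_div, le_div_iff₀ (mul_pos hc hwpos), mul_comm]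
  exact h1

/-- **THE UPPER HYPERSCALING INEQUALITY UNDER (A2)□** (`p_c(ℤ^d)`, `d ≥ 2`, `2 ≤ s ≤ L`, `ϰ > 0`): there is `C > 0` with
`Σ_{z ∈ Λ(n)} τ_{p_c}(0, z) ≤ C · (2n+1)^d · π_{p_c}(n)²` for every `n ≥ 1`, i.e. `E|C(0) ∩ Λ(n)| ≤ C |Λ(n)| π_n²`.
[cite: BorgsChayesKestenSpencer1999, §1 (hyperscaling relations)] [cite: BasuSapozhnikov2017ECP, §1 assumption (A2)] -/
theorem exists_sum_tau_le_of_setToSetQuasiMultAspectAt (hd : 2 ≤ d) {s L : ℕ} (hs : 2 ≤ s) (hsL : s ≤ L) {ϰ : ℝ}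
    (hϰ : 0 < ϰ) (h : SetToSetQuasiMultAspectAt d (criticalProbI d) s L ϰ) :
    ∃ C : ℝ, 0 < C ∧ ∀ n : ℕ, 1 ≤ n →
      ∑ z ∈ box d n, tau d (criticalProbI d) 0 z ≤ C * ((2 * (n : ℝ) + 1) ^ d * oneArmProb d (criticalProbI d) n ^ 2) := by
  have hd1 : 1 ≤ d := by omega
  obtain ⟨A, hA, hR1⟩ := exists_sq_oneArmProb_ratio_of_setToSetQuasiMultAspectAt hd hs hsL hϰ h
  set pc : unitInterval := criticalProbI d with hpcdef
  have hpc : 0 < (pc : ℝ) := by rw [hpcdef, coe_criticalProbI]; exact criticalProb_zd_pos d hd1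
  have hπ1 : 0 < oneArmProb d pc 1 := (pow_pos hpc 1).trans_le (DKT20.pow_le_real_siteToBoundary hd1 pc 1)
  have hd0 : (0 : ℝ) < d := by exact_mod_cast (by omega : 0 < d)
  set C₂ : ℝ := 2 * d * A * (192 : ℝ) ^ (d - 1) + (5 : ℝ) ^ d * (A * (16 : ℝ) ^ (d - 1) / oneArmProb d pc 1 ^ 2) with hC₂
  have hC₂pos : 0 < C₂ :=
    add_pos_of_pos_of_nonneg (by positivity) (mul_nonneg (by positivity) (div_nonneg (by positivity) (sq_nonneg _)))
  refine ⟨C₂, hC₂pos, fun n hn => ?_⟩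
  have hn0 : (0 : ℝ) < n := by exact_mod_cast hn
  have hnd : (n : ℝ) ^ d ≤ (2 * (n : ℝ) + 1) ^ d := pow_le_pow_left₀ hn0.le (by linarith) d
  calc ∑ z ∈ box d n, tau d pc 0 z ≤ C₂ * (n : ℝ) ^ d * oneArmProb d pc n ^ 2 := sum_tau_le_of_ratio hd1 pc hA.le hR1 hπ1 hn
    _ ≤ C₂ * (2 * (n : ℝ) + 1) ^ d * oneArmProb d pc n ^ 2 :=
        mul_le_mul_of_nonneg_right (mul_le_mul_of_nonneg_left hnd hC₂pos.le) (sq_nonneg _)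
    _ = C₂ * ((2 * (n : ℝ) + 1) ^ d * oneArmProb d pc n ^ 2) := by ring

/-- **`χ_n ≍ n^d π_n²` UNDER (A2)□, TWO-SIDED** (`p_c(ℤ^d)`, `d ≥ 2`, `2 ≤ s ≤ L`, `ϰ > 0`): `∃ 0 < c, C` with
`c·(2n+1)^d·π(n)² ≤ Σ_{z ∈ Λ(n)} τ(0,z) ≤ C·(2n+1)^d·π(n)²` for all `n ≥ 1` (lower half: gen 18; upper half: above) — the summed
form of Kesten's relation `2 − η = d − 2/ρ` (BCKS `2 − η = d(δ−1)/(δ+1)` with `dρ = δ+1`), conditional on the single LANE-4 input.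
[cite: BorgsChayesKestenSpencer1999, §1 (hyperscaling relations)] [cite: Kesten1987, §1 (scaling relations)] -/
theorem exists_sum_tau_two_sided_of_setToSetQuasiMultAspectAt (hd : 2 ≤ d) {s L : ℕ} (hs : 2 ≤ s) (hsL : s ≤ L) {ϰ : ℝ}
    (hϰ : 0 < ϰ) (h : SetToSetQuasiMultAspectAt d (criticalProbI d) s L ϰ) :
    ∃ c C : ℝ, 0 < c ∧ 0 < C ∧ ∀ n : ℕ, 1 ≤ n →
      c * ((2 * (n : ℝ) + 1) ^ d * oneArmProb d (criticalProbI d) n ^ 2) ≤ ∑ z ∈ box d n, tau d (criticalProbI d) 0 z ∧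
        ∑ z ∈ box d n, tau d (criticalProbI d) 0 z ≤ C * ((2 * (n : ℝ) + 1) ^ d * oneArmProb d (criticalProbI d) n ^ 2) := by
  obtain ⟨c, hc, hlow⟩ := exists_mul_card_mul_sq_oneArmProb_le_sum_tau_of_setToSetQuasiMultAspectAt hd h hϰ hs hsL
  obtain ⟨C, hC, hup⟩ := exists_sum_tau_le_of_setToSetQuasiMultAspectAt hd hs hsL hϰ h
  exact ⟨c, C, hc, hC, fun n hn => ⟨hlow n, hup n hn⟩⟩

open Classical in
/-- **FAT CLUSTERS AT THE IIC SCALE UNDER (A2)□** (`p_c(ℤ^d)`, `d ≥ 2`, `2 ≤ s ≤ L`, `ϰ > 0`): there are `λ, c > 0` with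
`c · π_{p_c}(n) ≤ P_{p_c}( λ·(2n+1)^d·π_{p_c}(n) ≤ #{z ∈ Λ(n) : 0 ↔ z} ∧ 0 ↔ ∂ⁱⁿΛ(⌊n/2⌋) )` for every `n ≥ 1` — with probability
comparable to the one-arm probability the critical cluster of the origin has the volume `≍ n^d π(n)` of the incipient infinite cluster
inside `Λ(n)` (second-moment method: `…VolumeSecondMoment`; inputs (R1), (R2) and gen 18's `τ ≥ c π(n)²` on `Λ(n)`, all from (A2)□).
[cite: BorgsChayesKestenSpencer1999, §1 (hyperscaling relations)] [cite: Kesten1986, Thm. (8)] [cite: BasuSapozhnikov2017ECP, §1 assumption (A2)] -/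
theorem exists_le_real_volume_ge_of_setToSetQuasiMultAspectAt (hd : 2 ≤ d) {s L : ℕ} (hs : 2 ≤ s) (hsL : s ≤ L) {ϰ : ℝ}
    (hϰ : 0 < ϰ) (h : SetToSetQuasiMultAspectAt d (criticalProbI d) s L ϰ) :
    ∃ lam c : ℝ, 0 < lam ∧ 0 < c ∧ ∀ n : ℕ, 1 ≤ n →
      c * oneArmProb d (criticalProbI d) n ≤ (bondPercolation (zdGraph d) (criticalProbI d)).real
        ({ω | lam * ((2 * (n : ℝ) + 1) ^ d * oneArmProb d (criticalProbI d) n) ≤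
            ((((box d n).filter fun z => ω ∈ (openConn (0 : Site d) z : Set (BondConfig (Site d)))).card : ℕ) : ℝ)} ∩
          siteToBoundary d (n / 2)) := by
  have hd1 : 1 ≤ d := by omega
  obtain ⟨A, hA, hR1⟩ := exists_sq_oneArmProb_ratio_of_setToSetQuasiMultAspectAt hd hs hsL hϰ h
  obtain ⟨B, hB, hR2⟩ := exists_oneArmProb_ratio_of_setToSetQuasiMultAspectAt hd hs hsL hϰ h
  obtain ⟨cL, hcL, hL⟩ := exists_mul_sq_oneArmProb_le_tau_box_of_setToSetQuasiMultAspectAt hd h hϰ hs hsL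
  set pc : unitInterval := criticalProbI d with hpcdef
  have hpc : 0 < (pc : ℝ) := by rw [hpcdef, coe_criticalProbI]; exact criticalProb_zd_pos d hd1
  have hπ1 : 0 < oneArmProb d pc 1 := (pow_pos hpc 1).trans_le (DKT20.pow_le_real_siteToBoundary hd1 pc 1)
  exact exists_le_real_volume_ge_of_ratio hd1 pc hA.le hB hcL hR1 hR2 hπ1 hL

/-- **The LOCAL two-point input at `p_c(ℤ^d)` from (A2)□** (`d ≥ 2`, `2 ≤ s ≤ L`, `ϰ > 0`): `∃ c > 0` with
`c · π_{p_c}(n)² ≤ P_{p_c}(0 ↔ x in Λ(4n))` for every `x ∈ Λ(n)` with `‖x‖_∞ ≥ L + 2` — gen 18's finite-volume theorem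
`c·π(‖x‖)² ≤ P[x ↔ 0 in Λ(4‖x‖)]` read in the larger box, with `π(n) ≤ π(‖x‖)`. [cite: Kesten1987, §1 (scaling relations)] [cite: BasuSapozhnikov2017ECP, §1 assumption (A2)] -/
theorem exists_mul_sq_oneArmProb_le_real_openConnIn_of_setToSetQuasiMultAspectAt (hd : 2 ≤ d) {s L : ℕ} (hs : 2 ≤ s)
    (hsL : s ≤ L) {ϰ : ℝ} (hϰ : 0 < ϰ) (h : SetToSetQuasiMultAspectAt d (criticalProbI d) s L ϰ) :
    ∃ c : ℝ, 0 < c ∧ ∀ (n : ℕ) (x : Site d), x ∈ box d n → L + 2 ≤ Site.supNorm x →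
      c * oneArmProb d (criticalProbI d) n ^ 2 ≤
        (bondPercolation (zdGraph d) (criticalProbI d)).real (openConnIn (↑(box d (4 * n)) : Set (Site d)) 0 x) := by
  obtain ⟨c, hc, hfv⟩ := exists_mul_sq_oneArmProb_le_real_openCrossing_of_setToSetQuasiMultAspectAt hd h hϰ hs hsL
  refine ⟨c, hc, fun n x hx hL2 => ?_⟩
  have hne : (Finset.univ : Finset (Fin d)).Nonempty := Finset.univ_nonempty_iff.2 ⟨⟨0, by omega⟩⟩
  obtain ⟨i, hi⟩ := Site.exists_natAbs_eq_supNorm hne x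
  have hmax : ∀ j, (x j).natAbs ≤ (x i).natAbs := fun j => by rw [hi]; exact Site.natAbs_le_supNorm x j
  have hxi : L + 2 ≤ (x i).natAbs := by rw [hi]; exact hL2
  have hxin : (x i).natAbs ≤ n := by rw [hi]; exact mem_box_iff_supNorm_le.1 hx
  have h1 := hfv x i hmax hxi
  have hmono : oneArmProb d (criticalProbI d) n ≤ oneArmProb d (criticalProbI d) (x i).natAbs :=
    DCT16.real_siteToBoundary_antitone _ hxin
  have hsub : (openCrossing (↑(box d (4 * (x i).natAbs)) : Set (Site d)) ↑({x} : Finset (Site d))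
      ↑({(0 : Site d)} : Finset (Site d)) : Set (BondConfig (Site d))) ⊆
      openConnIn (↑(box d (4 * n)) : Set (Site d)) 0 x := by
    intro ω hω
    rw [mem_openCrossing_iff] at hω
    obtain ⟨a, ha, b, hb, hab⟩ := hω
    rw [Finset.coe_singleton, Set.mem_singleton_iff] at ha hb
    subst ha; subst hb
    have hab' : ω ∈ openConnIn (↑(box d (4 * (a i).natAbs)) : Set (Site d)) 0 a := GM.openConnIn_comm.1 hab
    exact openConnIn_mono (Finset.coe_subset.2 (box_mono d (by omega))) 0 a hab'
  calc c * oneArmProb d (criticalProbI d) n ^ 2 ≤ c * oneArmProb d (criticalProbI d) (x i).natAbs ^ 2 :=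
        mul_le_mul_of_nonneg_left (pow_le_pow_left₀ measureReal_nonneg hmono 2) hc.le
    _ ≤ _ := h1
    _ ≤ _ := measureReal_mono hsub (measure_ne_top _ _)

open Classical in
/-- **LOCAL FAT CLUSTERS UNDER (A2)□** (`p_c(ℤ^d)`, `d ≥ 2`, `2 ≤ s ≤ L`, `ϰ > 0`): there are `λ, c > 0` with, for every `n ≥ 1`,
`c · π_{p_c}(n) ≤ P_{p_c}( λ(2n+1)^dπ_{p_c}(n) ≤ #{z ∈ Λ(n) : 0 ↔ z in Λ(4n)} ∧ 0 ↔ ∂ⁱⁿΛ(⌊n/2⌋) )` — the fat-cluster event in a form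
DETERMINED INSIDE `Λ(4n)` (for independence across disjoint boxes; `exists_le_real_card_ge_of_ratio` with `F n x = {0 ↔ x in Λ(4n)}`,
`n₀ = L + 2`). [cite: BorgsChayesKestenSpencer1999, §1 (hyperscaling relations)] [cite: BasuSapozhnikov2017ECP, §1 assumption (A2)] -/
theorem exists_le_real_localVolume_ge_of_setToSetQuasiMultAspectAt (hd : 2 ≤ d) {s L : ℕ} (hs : 2 ≤ s) (hsL : s ≤ L) {ϰ : ℝ}
    (hϰ : 0 < ϰ) (h : SetToSetQuasiMultAspectAt d (criticalProbI d) s L ϰ) :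
    ∃ lam c : ℝ, 0 < lam ∧ 0 < c ∧ ∀ n : ℕ, 1 ≤ n →
      c * oneArmProb d (criticalProbI d) n ≤ (bondPercolation (zdGraph d) (criticalProbI d)).real
        ({ω | lam * ((2 * (n : ℝ) + 1) ^ d * oneArmProb d (criticalProbI d) n) ≤
            ((((box d n).filter fun z => ω ∈ (openConnIn (↑(box d (4 * n)) : Set (Site d)) (0 : Site d) z :
              Set (BondConfig (Site d)))).card : ℕ) : ℝ)} ∩ siteToBoundary d (n / 2)) := by
  have hd1 : 1 ≤ d := by omega
  obtain ⟨A, hA, hR1⟩ := exists_sq_oneArmProb_ratio_of_setToSetQuasiMultAspectAt hd hs hsL hϰ h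
  obtain ⟨B, hB, hR2⟩ := exists_oneArmProb_ratio_of_setToSetQuasiMultAspectAt hd hs hsL hϰ h
  obtain ⟨cL, hcL, hL⟩ := exists_mul_sq_oneArmProb_le_real_openConnIn_of_setToSetQuasiMultAspectAt hd hs hsL hϰ h
  set pc : unitInterval := criticalProbI d with hpcdef
  have hpc : 0 < (pc : ℝ) := by rw [hpcdef, coe_criticalProbI]; exact criticalProb_zd_pos d hd1
  have hπ1 : 0 < oneArmProb d pc 1 := (pow_pos hpc 1).trans_le (DKT20.pow_le_real_siteToBoundary hd1 pc 1)
  refine exists_le_real_card_ge_of_ratio hd1 pc hA.le hB hcL hR1 hR2 hπ1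
    (fun n x => (openConnIn (↑(box d (4 * n)) : Set (Site d)) (0 : Site d) x : Set (BondConfig (Site d))))
    (fun n x => fun ω hω => DCT16.reachable_of_pathIn (DCT16.pathIn_of_mem_openConnIn hω))
    (fun n x => DCT16.measurableSet_openConnIn (box d (4 * n)) 0 x) (fun n ω => ?_) (n₀ := L + 2)
    (fun n x hx hL2 _ => hL n x hx hL2)
  have h0 : (0 : Site d) ∈ (↑(box d (4 * n)) : Set (Site d)) := Finset.mem_coe.2 (zero_mem_box d _)
  exact ⟨h0, h0, SimpleGraph.Reachable.refl _⟩

open Classical in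
/-- **Conditional form: given the arm to `∂ⁱⁿΛ(⌊n/2⌋)`, the cluster is fat with probability `≥ c`** (`p_c(ℤ^d)`, `d ≥ 2`, (A2)□ at `(s,L)`,
`2 ≤ s ≤ L`, `ϰ > 0`): `∃ λ, c > 0, ∀ n ≥ 1, c · π_{p_c}(⌊n/2⌋) ≤ P_{p_c}( λ(2n+1)^dπ_{p_c}(n) ≤ #{z ∈ Λ(n) : 0 ↔ z} ∧ 0 ↔ ∂ⁱⁿΛ(⌊n/2⌋) )`
(the previous bound and (R2): `π(⌊n/2⌋) ≤ B π(n)`). [cite: Kesten1986, Thm. (8)] [cite: BasuSapozhnikov2017ECP, §1 assumption (A2)] -/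
theorem exists_le_real_volume_ge_cond_of_setToSetQuasiMultAspectAt (hd : 2 ≤ d) {s L : ℕ} (hs : 2 ≤ s) (hsL : s ≤ L) {ϰ : ℝ}
    (hϰ : 0 < ϰ) (h : SetToSetQuasiMultAspectAt d (criticalProbI d) s L ϰ) :
    ∃ lam c : ℝ, 0 < lam ∧ 0 < c ∧ ∀ n : ℕ, 1 ≤ n →
      c * oneArmProb d (criticalProbI d) (n / 2) ≤ (bondPercolation (zdGraph d) (criticalProbI d)).real
        ({ω | lam * ((2 * (n : ℝ) + 1) ^ d * oneArmProb d (criticalProbI d) n) ≤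
            ((((box d n).filter fun z => ω ∈ (openConn (0 : Site d) z : Set (BondConfig (Site d)))).card : ℕ) : ℝ)} ∩
          siteToBoundary d (n / 2)) := by
  have hd1 : 1 ≤ d := by omega
  obtain ⟨lam, c, hlam, hc, hmain⟩ := exists_le_real_volume_ge_of_setToSetQuasiMultAspectAt hd hs hsL hϰ h
  obtain ⟨B, hB, hR2⟩ := exists_oneArmProb_ratio_of_setToSetQuasiMultAspectAt hd hs hsL hϰ h
  set pc : unitInterval := criticalProbI d with hpcdef
  have hpc : 0 < (pc : ℝ) := by rw [hpcdef, coe_criticalProbI]; exact criticalProb_zd_pos d hd1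
  have hπ1 : 0 < oneArmProb d pc 1 := (pow_pos hpc 1).trans_le (DKT20.pow_le_real_siteToBoundary hd1 pc 1)
  -- `π(⌊n/2⌋) ≤ B' π(n)` for all `n ≥ 1`, `B' = max B (π(1)⁻¹)`
  set B' : ℝ := max B (oneArmProb d pc 1)⁻¹ with hB'
  have hB'pos : 0 < B' := lt_max_of_lt_left hB
  have hratio : ∀ n : ℕ, 1 ≤ n → oneArmProb d pc (n / 2) ≤ B' * oneArmProb d pc n := by
    intro n hn
    by_cases hn2 : n = 1
    · subst hn2
      have hπ0 : oneArmProb d pc (1 / 2) ≤ 1 := measureReal_le_one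
      calc oneArmProb d pc (1 / 2) ≤ 1 := hπ0
        _ = (oneArmProb d pc 1)⁻¹ * oneArmProb d pc 1 := (inv_mul_cancel₀ hπ1.ne').symm
        _ ≤ B' * oneArmProb d pc 1 := mul_le_mul_of_nonneg_right (le_max_right _ _) hπ1.le
    · exact (hR2 (n / 2) n (by omega) (Nat.div_le_self n 2) (by omega)).trans
        (mul_le_mul_of_nonneg_right (le_max_left _ _) measureReal_nonneg)
  refine ⟨lam, c / B', hlam, div_pos hc hB'pos, fun n hn => ?_⟩
  calc c / B' * oneArmProb d pc (n / 2) ≤ c / B' * (B' * oneArmProb d pc n) :=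
        mul_le_mul_of_nonneg_left (hratio n hn) (div_pos hc hB'pos).le
    _ = c * oneArmProb d pc n := by field_simp
    _ ≤ _ := hmain n hn

open Classical in
/-- **VOLUME UPPER TAIL UNDER (A2)□** (`p_c(ℤ^d)`, `d ≥ 2`, `2 ≤ s ≤ L`, `ϰ > 0`): for every `λ > 0` there is `C > 0` with
`P_{p_c}( λ·(2n+1)^d·π_{p_c}(n) ≤ #{z ∈ Λ(R) : 0 ↔ z} ) ≤ C · π_{p_c}(n)` for all `n ≥ 1` and all `R` — hence for the full volume
`|C(0)| ≥ λ(2n+1)^dπ(n)` (arm to `∂ⁱⁿΛ(n)`, or Markov with the upper hyperscaling inequality).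
[cite: BorgsChayesKestenSpencer1999, §1 (hyperscaling relations)] [cite: BasuSapozhnikov2017ECP, §1 assumption (A2)] -/
theorem exists_real_volume_ge_le_of_setToSetQuasiMultAspectAt (hd : 2 ≤ d) {s L : ℕ} (hs : 2 ≤ s) (hsL : s ≤ L) {ϰ : ℝ}
    (hϰ : 0 < ϰ) (h : SetToSetQuasiMultAspectAt d (criticalProbI d) s L ϰ) {lam : ℝ} (hlam : 0 < lam) :
    ∃ C : ℝ, 0 < C ∧ ∀ n : ℕ, 1 ≤ n → ∀ R : ℕ,
      (bondPercolation (zdGraph d) (criticalProbI d)).real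
          {ω | lam * ((2 * (n : ℝ) + 1) ^ d * oneArmProb d (criticalProbI d) n) ≤
            ((((box d R).filter fun z => ω ∈ (openConn (0 : Site d) z : Set (BondConfig (Site d)))).card : ℕ) : ℝ)} ≤
        C * oneArmProb d (criticalProbI d) n := by
  have hd1 : 1 ≤ d := by omega
  obtain ⟨A, hA, hR1⟩ := exists_sq_oneArmProb_ratio_of_setToSetQuasiMultAspectAt hd hs hsL hϰ h
  set pc : unitInterval := criticalProbI d with hpcdef
  have hpc : 0 < (pc : ℝ) := by rw [hpcdef, coe_criticalProbI]; exact criticalProb_zd_pos d hd1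
  have hd0 : (0 : ℝ) < d := by exact_mod_cast (by omega : 0 < d)
  refine ⟨1 + (2 * d * A * (192 : ℝ) ^ (d - 1) + (5 : ℝ) ^ d * (A * (16 : ℝ) ^ (d - 1) / oneArmProb d pc 1 ^ 2)) / lam,
    add_pos_of_pos_of_nonneg one_pos (div_nonneg (add_nonneg (by positivity)
      (mul_nonneg (by positivity) (div_nonneg (by positivity) (sq_nonneg _)))) hlam.le), fun n hn R => ?_⟩
  exact real_volume_ge_le_of_ratio hd1 pc hpc hA.le hR1 hlam hn R

open Classical in
/-- **THE VOLUME–RADIUS HYPERSCALING RELATION `dρ = δ + 1` UNDER (A2)□, IN RATIO FORM** (`p_c(ℤ^d)`, `d ≥ 2`, `2 ≤ s ≤ L`, `ϰ > 0`):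
there are `λ > 0` and `0 < c ≤ C` such that for all `1 ≤ n ≤ R`,
`c · π_{p_c}(n) ≤ P_{p_c}( λ·(2n+1)^d·π_{p_c}(n) ≤ #{z ∈ Λ(R) : 0 ↔ z} ) ≤ C · π_{p_c}(n)`.
Reading: with `s(n) = λ|Λ(n)|π(n)` (the IIC volume at scale `n`), `P(|C(0)| ≥ s(n)) ≍ π(n)` uniformly — if `π(n) ≈ n^{−1/ρ}` and
`P(|C| ≥ s) ≈ s^{−1/δ}` this is `δ = dρ − 1` (BCKS 1999 derive `dρ = δ+1` from their box-crossing postulates and the existence of the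
exponents; here both directions follow from Basu–Sapozhnikov's (A2)□ alone, in every dimension, with no exponent assumed).
[cite: BorgsChayesKestenSpencer1999, §1 (hyperscaling relations)] [cite: BasuSapozhnikov2017ECP, §1 assumption (A2)] -/
theorem exists_real_volume_ge_two_sided_of_setToSetQuasiMultAspectAt (hd : 2 ≤ d) {s L : ℕ} (hs : 2 ≤ s) (hsL : s ≤ L) {ϰ : ℝ}
    (hϰ : 0 < ϰ) (h : SetToSetQuasiMultAspectAt d (criticalProbI d) s L ϰ) :
    ∃ lam c C : ℝ, 0 < lam ∧ 0 < c ∧ 0 < C ∧ ∀ n R : ℕ, 1 ≤ n → n ≤ R →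
      c * oneArmProb d (criticalProbI d) n ≤ (bondPercolation (zdGraph d) (criticalProbI d)).real
          {ω | lam * ((2 * (n : ℝ) + 1) ^ d * oneArmProb d (criticalProbI d) n) ≤
            ((((box d R).filter fun z => ω ∈ (openConn (0 : Site d) z : Set (BondConfig (Site d)))).card : ℕ) : ℝ)} ∧
        (bondPercolation (zdGraph d) (criticalProbI d)).real
          {ω | lam * ((2 * (n : ℝ) + 1) ^ d * oneArmProb d (criticalProbI d) n) ≤
            ((((box d R).filter fun z => ω ∈ (openConn (0 : Site d) z : Set (BondConfig (Site d)))).card : ℕ) : ℝ)} ≤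
          C * oneArmProb d (criticalProbI d) n := by
  classical
  obtain ⟨lam, c, hlam, hc, hlow⟩ := exists_le_real_volume_ge_of_setToSetQuasiMultAspectAt hd hs hsL hϰ h
  obtain ⟨C, hC, hup⟩ := exists_real_volume_ge_le_of_setToSetQuasiMultAspectAt hd hs hsL hϰ h hlam
  refine ⟨lam, c, C, hlam, hc, hC, fun n R hn hnR => ⟨?_, hup n hn R⟩⟩
  refine (hlow n hn).trans (measureReal_mono ?_ (measure_ne_top _ _))
  rintro ω ⟨hω, -⟩
  rw [Set.mem_setOf_eq] at hω ⊢
  refine hω.trans ?_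
  exact_mod_cast card_filter_openConn_mono hnR ω

/-! ## Planar instances (unconditional, via p1's planar (A2)□ from RSW) -/

/-- **On `ℤ²` at `p_c = 1/2`, UNCONDITIONALLY: `E|C(0) ∩ Λ(n)| ≍ n² π_{1/2}(n)²`** (`∃ 0 < c, C`, all `n ≥ 1`) — Kesten 1987's
relation `2 − η = d − 2/ρ` (`d = 2`) in summed, two-sided form (numerically `η = 5/24 = 2·(5/48)`). [cite: Kesten1987, §1 (scaling relations)] -/
theorem exists_sum_tau_two_sided_Z2 :
    ∃ c C : ℝ, 0 < c ∧ 0 < C ∧ ∀ n : ℕ, 1 ≤ n →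
      c * ((2 * (n : ℝ) + 1) ^ 2 * oneArmProb 2 (criticalProbI 2) n ^ 2) ≤ ∑ z ∈ box 2 n, tau 2 (criticalProbI 2) 0 z ∧
        ∑ z ∈ box 2 n, tau 2 (criticalProbI 2) 0 z ≤ C * ((2 * (n : ℝ) + 1) ^ 2 * oneArmProb 2 (criticalProbI 2) n ^ 2) := by
  obtain ⟨ϰ, hϰ, hA2⟩ := exists_setToSetQuasiMultAspectAt_two_of_criticalProbI_le
  exact exists_sum_tau_two_sided_of_setToSetQuasiMultAspectAt (d := 2) le_rfl (by norm_num) (by norm_num) hϰ (hA2 _ le_rfl)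

open Classical in
/-- **On `ℤ²` at `p_c = 1/2`, UNCONDITIONALLY: `P_{1/2}(|C(0)| ≥ λ|Λ(n)|π(n)) ≍ π(n)`** — the planar hyperscaling relation
`δ = 2ρ − 1 (= 91/5)` in ratio form: `∃ λ > 0, 0 < c ≤ C, ∀ 1 ≤ n ≤ R,
c π(n) ≤ P(λ(2n+1)²π(n) ≤ #{z ∈ Λ(R) : 0 ↔ z}) ≤ C π(n)`. [cite: Kesten1987, §1 (scaling relations)] [cite: Kesten1986, Thm. (8)] -/
theorem exists_real_volume_ge_two_sided_Z2 :
    ∃ lam c C : ℝ, 0 < lam ∧ 0 < c ∧ 0 < C ∧ ∀ n R : ℕ, 1 ≤ n → n ≤ R →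
      c * oneArmProb 2 (criticalProbI 2) n ≤ (bondPercolation (zdGraph 2) (criticalProbI 2)).real
          {ω | lam * ((2 * (n : ℝ) + 1) ^ 2 * oneArmProb 2 (criticalProbI 2) n) ≤
            ((((box 2 R).filter fun z => ω ∈ (openConn (0 : Site 2) z : Set (BondConfig (Site 2)))).card : ℕ) : ℝ)} ∧
        (bondPercolation (zdGraph 2) (criticalProbI 2)).real
          {ω | lam * ((2 * (n : ℝ) + 1) ^ 2 * oneArmProb 2 (criticalProbI 2) n) ≤
            ((((box 2 R).filter fun z => ω ∈ (openConn (0 : Site 2) z : Set (BondConfig (Site 2)))).card : ℕ) : ℝ)} ≤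
          C * oneArmProb 2 (criticalProbI 2) n := by
  obtain ⟨ϰ, hϰ, hA2⟩ := exists_setToSetQuasiMultAspectAt_two_of_criticalProbI_le
  exact exists_real_volume_ge_two_sided_of_setToSetQuasiMultAspectAt (d := 2) le_rfl (by norm_num) (by norm_num) hϰ (hA2 _ le_rfl)

end Rsw3

end Summit.CriticalPhenomena.PercolationContinuityZ3.Theorems
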